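import Mathlib
import HarnessLib
import Literature.MathematicalPhysics.StatisticalMechanics.TuningMapOfHamiltonian
import Summits.HubbardSuperconductivity.HubbardSuperconductivity.Theorems.ComplexGFFStiffnessHypALocalTwoPointFormChangeBounds
import Summits.HubbardSuperconductivity.HubbardSuperconductivity.Theorems.ComplexGFFStiffnessHypALocalTwoPointSecondDifferences

/-!
# Crux `HypALocalTwoPoint`, line `gnv` — the Gaussian part of the free energy as a function of the
# RELEVANT SEED: `x ↦ log κ_{𝟙,𝟙+q(x)}` is `|Λ|·c`-Lipschitz with `2|Λ|c²`-Lipschitz first differences on a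
# ball of the Banach space of relevant Hamiltonians

Route `route-HubbardSuperconductivity-ComplexGFFStiffness`, crux item stmt-HubbardSuperconductivity-19155,
registered stub `stub_twoPointGivenZ`, census F1/F2 of the memo FREEENERGY-PLAN-cgffstiff2-g1: the free
energy contains `log κ_{𝟙,𝟙+q(ℋ⋆(𝒦))}` with `q = hamQuadForm ∘ toHam` LINEAR in the seed
(`Literature/…/TuningMapOfHamiltonian`, `Σ|q(H)_{ij}| ≤ c·‖H‖`, `c = 2d²/(n(𝔥/R)²)`).  Composing with
`…FormChangeBounds` (mode-by-mode bounds, `|Λ|` per unit of form size) gives, on the ball `c‖x‖ ≤ ½`: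

* `abs_quadForm_le_entrySum` — `|zᵀmz| ≤ (Σ|m_{ij}|)·|z|²`;
* `hamQuadForm_add` — additivity of `q`;
* **`abs_log_formChangeConst_seed_sub_le`** — `|g(x₁) − g(x₂)| ≤ |Λ|·c·‖x₁ − x₂‖`,
  `g(x) = log κ_{𝟙,𝟙+q(toHam x)}`;
* **`abs_secondDiff_log_formChangeConst_seed_le`** — parallelogram second differences `≤ 2|Λ|c²‖y‖‖z‖`;
* **`abs_secondDiff_log_formChangeConst_seed_quad_le`** — over four ARBITRARY seeds of the `(6c)⁻¹`-ball
  (the four fixed points `ℋ⋆(𝒦 + iU + jV)` do not form a parallelogram): quadrilateral estimate.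

All proved, no `sorry`.

## References
* S. Adams, S. Buchholz, R. Kotecký, S. Müller, arXiv:1910.13564, Ch. 4.2 (4.7), Ch. 12.1 (12.8)–(12.11),
  Theorem 2.2 [AdamsBuchholzKoteckyMuller2019].
-/

noncomputable section

-- `Summit.<Summit>.<Problem>`: single-conjunct summit, the duplicate component is mandated (D-0017).
set_option linter.dupNamespace false

namespace Summit.HubbardSuperconductivity.HubbardSuperconductivity.Theorems.ComplexGFF

open scoped BigOperators Matrix
open Finset Matrix
open Literature.MathematicalPhysics.StatisticalMechanics.GradientRG

variable {d M : ℕ} [NeZero M]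

/-! ## Quadratic forms with small entries -/

omit [NeZero M] in
/-- `|zᵀmz| ≤ (Σ_{ij}|m_{ij}|)·Σ_k z_k²`. -/
theorem abs_quadForm_le_entrySum (m : Matrix (Fin d) (Fin d) ℝ) (z : Fin d → ℝ) :
    |∑ i, ∑ j, z i * m i j * z j| ≤ (∑ i, ∑ j, |m i j|) * ∑ k, (z k) ^ 2 := by
  set S := ∑ k, (z k) ^ 2 with hS
  have hS0 : 0 ≤ S := Finset.sum_nonneg fun k _ => sq_nonneg _
  have hzz : ∀ i j, |z i| * |z j| ≤ S := by
    intro i j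
    have hi : (z i) ^ 2 ≤ S := Finset.single_le_sum (f := fun k => (z k) ^ 2) (fun k _ => sq_nonneg _) (mem_univ i)
    have hj : (z j) ^ 2 ≤ S := Finset.single_le_sum (f := fun k => (z k) ^ 2) (fun k _ => sq_nonneg _) (mem_univ j)
    nlinarith [two_mul_le_add_sq (|z i|) (|z j|), sq_abs (z i), sq_abs (z j), abs_nonneg (z i), abs_nonneg (z j)]
  calc |∑ i, ∑ j, z i * m i j * z j| ≤ ∑ i, |∑ j, z i * m i j * z j| := Finset.abs_sum_le_sum_abs _ _
    _ ≤ ∑ i, ∑ j, |z i * m i j * z j| := Finset.sum_le_sum fun i _ => Finset.abs_sum_le_sum_abs _ _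
    _ ≤ ∑ i, ∑ j, |m i j| * S := by
        refine Finset.sum_le_sum fun i _ => Finset.sum_le_sum fun j _ => ?_
        rw [abs_mul, abs_mul]
        calc |z i| * |m i j| * |z j| = |m i j| * (|z i| * |z j|) := by ring
          _ ≤ |m i j| * S := mul_le_mul_of_nonneg_left (hzz i j) (abs_nonneg _)
    _ = (∑ i, ∑ j, |m i j|) * S := by rw [Finset.sum_mul]; exact Finset.sum_congr rfl fun i _ => by rw [Finset.sum_mul]

omit [NeZero M] in
/-- `q` is additive: `q(H + H') = q(H) + q(H')`. -/
theorem hamQuadForm_add (H H' : RelevantHamiltonian ℂ d) : hamQuadForm (H + H') = hamQuadForm H + hamQuadForm H' := by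
  have h := hamQuadForm_sub (H + H') H'
  rw [add_sub_cancel_right] at h
  rw [h, sub_add_cancel]

/-! ## The Gaussian factor along the seed -/

section Seed

variable {𝔥 R : ℝ} {n : ℕ} [Fact (0 < 𝔥)] [Fact (0 < R)] [Fact (0 < n)]

/-- The form bound of `q(toHam x)` from the coefficient norm: `|zᵀq(x)z| ≤ c‖x‖·|z|²`, `c = 2d²/(n(𝔥/R)²)`. -/
theorem abs_quadForm_hamQuadForm_le (x : HamSpace ℂ d 𝔥 R n)
    (z : Fin d → ℝ) :
    |∑ i, ∑ j, z i * hamQuadForm (HamSpace.toHam x) i j * z j|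
      ≤ (2 * (d : ℝ) ^ 2 / ((n : ℝ) * (𝔥 / R) ^ 2) * ‖x‖) * ∑ k, (z k) ^ 2 := by
  have h𝔥 : 0 < 𝔥 := Fact.out
  have hR : 0 < R := Fact.out
  have hn : 1 ≤ n := (Fact.out : 0 < n)
  refine (abs_quadForm_le_entrySum _ z).trans (mul_le_mul_of_nonneg_right ?_ (Finset.sum_nonneg fun k _ => sq_nonneg _))
  rw [HamSpace.norm_def]
  exact entrySum_hamQuadForm_le h𝔥 hR hn _

/-- **Lipschitz bound of `x ↦ log κ_{𝟙,𝟙+q(x)}` on the ball `c‖x‖ ≤ ½`**: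
`|log κ_{𝟙,𝟙+q(x₁)} − log κ_{𝟙,𝟙+q(x₂)}| ≤ |Λ|·c·‖x₁ − x₂‖` (`|Λ| = M^d`, `c = 2d²/(n(𝔥/R)²)`). -/
theorem abs_log_formChangeConst_seed_sub_le (x₁ x₂ : HamSpace ℂ d 𝔥 R n)
    (hx₁ : 2 * (d : ℝ) ^ 2 / ((n : ℝ) * (𝔥 / R) ^ 2) * ‖x₁‖ ≤ 1 / 2)
    (hx₂ : 2 * (d : ℝ) ^ 2 / ((n : ℝ) * (𝔥 / R) ^ 2) * ‖x₂‖ ≤ 1 / 2) :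
    |Real.log (formChangeConst (M := M) (1 : Matrix (Fin d) (Fin d) ℝ) (1 + hamQuadForm (HamSpace.toHam x₁)))
        - Real.log (formChangeConst (M := M) (1 : Matrix (Fin d) (Fin d) ℝ) (1 + hamQuadForm (HamSpace.toHam x₂)))|
      ≤ (Fintype.card (Fin d → ZMod M) : ℝ) * (2 * (d : ℝ) ^ 2 / ((n : ℝ) * (𝔥 / R) ^ 2) * ‖x₁ - x₂‖) := by
  set c := 2 * (d : ℝ) ^ 2 / ((n : ℝ) * (𝔥 / R) ^ 2) with hc
  have hc0 : 0 ≤ c := by rw [hc]; positivity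
  have hs₁ : ∀ z : Fin d → ℝ, |∑ i, ∑ j, z i * hamQuadForm (HamSpace.toHam x₁) i j * z j| ≤ (1 / 2 : ℝ) * ∑ i, (z i) ^ 2 :=
    fun z => (abs_quadForm_hamQuadForm_le x₁ z).trans
      (mul_le_mul_of_nonneg_right hx₁ (Finset.sum_nonneg fun k _ => sq_nonneg _))
  have hs₂ : ∀ z : Fin d → ℝ, |∑ i, ∑ j, z i * hamQuadForm (HamSpace.toHam x₂) i j * z j| ≤ (1 / 2 : ℝ) * ∑ i, (z i) ^ 2 :=
    fun z => (abs_quadForm_hamQuadForm_le x₂ z).trans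
      (mul_le_mul_of_nonneg_right hx₂ (Finset.sum_nonneg fun k _ => sq_nonneg _))
  have hdiff : hamQuadForm (HamSpace.toHam x₁) - hamQuadForm (HamSpace.toHam x₂) = hamQuadForm (HamSpace.toHam (x₁ - x₂)) := by
    rw [map_sub, hamQuadForm_sub]
  have ht : ∀ z : Fin d → ℝ,
      |∑ i, ∑ j, z i * (hamQuadForm (HamSpace.toHam x₁) - hamQuadForm (HamSpace.toHam x₂)) i j * z j| ≤ (c * ‖x₁ - x₂‖) * ∑ i, (z i) ^ 2 := by
    intro z
    rw [hdiff]
    exact abs_quadForm_hamQuadForm_le (x₁ - x₂) z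
  exact abs_log_formChangeConst_sub_le (hamQuadForm_isSymm _) (hamQuadForm_isSymm _) hs₁ hs₂
    (mul_nonneg hc0 (norm_nonneg _)) ht

/-- **Parallelogram second differences of `x ↦ log κ_{𝟙,𝟙+q(x)}`**: for `x, x+y, x+z, x+y+z` in the ball
`c‖·‖ ≤ ½`: `|Σ± log κ| ≤ 2|Λ|·(c‖y‖)·(c‖z‖)`. -/
theorem abs_secondDiff_log_formChangeConst_seed_le (x y z : HamSpace ℂ d 𝔥 R n)
    (hx : 2 * (d : ℝ) ^ 2 / ((n : ℝ) * (𝔥 / R) ^ 2) * ‖x‖ ≤ 1 / 2)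
    (hxy : 2 * (d : ℝ) ^ 2 / ((n : ℝ) * (𝔥 / R) ^ 2) * ‖x + y‖ ≤ 1 / 2)
    (hxz : 2 * (d : ℝ) ^ 2 / ((n : ℝ) * (𝔥 / R) ^ 2) * ‖x + z‖ ≤ 1 / 2)
    (hxyz : 2 * (d : ℝ) ^ 2 / ((n : ℝ) * (𝔥 / R) ^ 2) * ‖x + y + z‖ ≤ 1 / 2) :
    |Real.log (formChangeConst (M := M) (1 : Matrix (Fin d) (Fin d) ℝ) (1 + hamQuadForm (HamSpace.toHam (x + y + z))))
        - Real.log (formChangeConst (M := M) (1 : Matrix (Fin d) (Fin d) ℝ) (1 + hamQuadForm (HamSpace.toHam (x + y))))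
        - Real.log (formChangeConst (M := M) (1 : Matrix (Fin d) (Fin d) ℝ) (1 + hamQuadForm (HamSpace.toHam (x + z))))
        + Real.log (formChangeConst (M := M) (1 : Matrix (Fin d) (Fin d) ℝ) (1 + hamQuadForm (HamSpace.toHam x)))|
      ≤ 2 * (Fintype.card (Fin d → ZMod M) : ℝ) * (2 * (d : ℝ) ^ 2 / ((n : ℝ) * (𝔥 / R) ^ 2) * ‖y‖)
          * (2 * (d : ℝ) ^ 2 / ((n : ℝ) * (𝔥 / R) ^ 2) * ‖z‖) := by
  set c := 2 * (d : ℝ) ^ 2 / ((n : ℝ) * (𝔥 / R) ^ 2) with hc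
  have hc0 : 0 ≤ c := by rw [hc]; positivity
  have bound : ∀ (w : HamSpace ℂ d 𝔥 R n), c * ‖w‖ ≤ 1 / 2 →
      ∀ zz : Fin d → ℝ, |∑ i, ∑ j, zz i * hamQuadForm (HamSpace.toHam w) i j * zz j| ≤ (1 / 2 : ℝ) * ∑ i, (zz i) ^ 2 :=
    fun w hw zz => (abs_quadForm_hamQuadForm_le w zz).trans
      (mul_le_mul_of_nonneg_right hw (Finset.sum_nonneg fun k _ => sq_nonneg _))
  have eY : hamQuadForm (HamSpace.toHam (x + y)) = hamQuadForm (HamSpace.toHam x) + hamQuadForm (HamSpace.toHam y) := by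
    rw [map_add, hamQuadForm_add]
  have eZ : hamQuadForm (HamSpace.toHam (x + z)) = hamQuadForm (HamSpace.toHam x) + hamQuadForm (HamSpace.toHam z) := by
    rw [map_add, hamQuadForm_add]
  have eYZ : hamQuadForm (HamSpace.toHam (x + y + z))
      = hamQuadForm (HamSpace.toHam x) + hamQuadForm (HamSpace.toHam y) + hamQuadForm (HamSpace.toHam z) := by
    rw [map_add, hamQuadForm_add, eY]
  have hs := bound x hx
  have hsa := bound (x + y) hxy
  have hsb := bound (x + z) hxz
  have hsab := bound (x + y + z) hxyz
  rw [eY] at hsa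
  rw [eZ] at hsb
  rw [eYZ] at hsab
  rw [eY, eZ, eYZ]
  exact abs_secondDiff_log_formChangeConst_le (hamQuadForm_isSymm _) (hamQuadForm_isSymm _) (hamQuadForm_isSymm _)
    hs hsa hsb hsab (mul_nonneg hc0 (norm_nonneg _)) (abs_quadForm_hamQuadForm_le y)
    (mul_nonneg hc0 (norm_nonneg _)) (abs_quadForm_hamQuadForm_le z)

/-- **Second differences of `x ↦ log κ_{𝟙,𝟙+q(x)}` over four ARBITRARY seeds** (`a₀₀, a₁₀, a₀₁` in the
ball `c‖·‖ ≤ 1/6`, `a₁₁` in the ball `c‖·‖ ≤ ½`): the quadrilateral estimate with Lipschitz constant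
`|Λ|c` and parallelogram constant `2|Λ|c²` — the form used on the four tuned seeds `ℋ⋆(𝒦 + iU + jV)`. -/
theorem abs_secondDiff_log_formChangeConst_seed_quad_le {a₀₀ a₁₀ a₀₁ a₁₁ : HamSpace ℂ d 𝔥 R n}
    (h₀₀ : 2 * (d : ℝ) ^ 2 / ((n : ℝ) * (𝔥 / R) ^ 2) * ‖a₀₀‖ ≤ 1 / 6)
    (h₁₀ : 2 * (d : ℝ) ^ 2 / ((n : ℝ) * (𝔥 / R) ^ 2) * ‖a₁₀‖ ≤ 1 / 6)
    (h₀₁ : 2 * (d : ℝ) ^ 2 / ((n : ℝ) * (𝔥 / R) ^ 2) * ‖a₀₁‖ ≤ 1 / 6)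
    (h₁₁ : 2 * (d : ℝ) ^ 2 / ((n : ℝ) * (𝔥 / R) ^ 2) * ‖a₁₁‖ ≤ 1 / 2) :
    |Real.log (formChangeConst (M := M) (1 : Matrix (Fin d) (Fin d) ℝ) (1 + hamQuadForm (HamSpace.toHam a₁₁)))
        - Real.log (formChangeConst (M := M) (1 : Matrix (Fin d) (Fin d) ℝ) (1 + hamQuadForm (HamSpace.toHam a₁₀)))
        - Real.log (formChangeConst (M := M) (1 : Matrix (Fin d) (Fin d) ℝ) (1 + hamQuadForm (HamSpace.toHam a₀₁)))
        + Real.log (formChangeConst (M := M) (1 : Matrix (Fin d) (Fin d) ℝ) (1 + hamQuadForm (HamSpace.toHam a₀₀)))|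
      ≤ (Fintype.card (Fin d → ZMod M) : ℝ) * (2 * (d : ℝ) ^ 2 / ((n : ℝ) * (𝔥 / R) ^ 2))
            * ‖a₁₁ - a₁₀ - a₀₁ + a₀₀‖
        + 2 * (Fintype.card (Fin d → ZMod M) : ℝ) * (2 * (d : ℝ) ^ 2 / ((n : ℝ) * (𝔥 / R) ^ 2)) ^ 2
            * ‖a₁₀ - a₀₀‖ * ‖a₀₁ - a₀₀‖ := by
  set c := 2 * (d : ℝ) ^ 2 / ((n : ℝ) * (𝔥 / R) ^ 2) with hc
  have hc0 : 0 ≤ c := by rw [hc]; positivity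
  set V : ℝ := (Fintype.card (Fin d → ZMod M) : ℝ) with hV
  by_cases hcz : c = 0
  · -- degenerate constant: then all seeds satisfy the ball conditions trivially; use the radius-free form
    -- via the Lipschitz/parallelogram bounds with `c = 0` (both sides vanish)
    -- with `c = 0` the hypotheses `c‖·‖ ≤ ½` hold for every seed
    have hball : ∀ w : HamSpace ℂ d 𝔥 R n, c * ‖w‖ ≤ 1 / 2 := fun w => by rw [hcz, zero_mul]; norm_num
    set g : HamSpace ℂ d 𝔥 R n → ℝ := fun w =>
      Real.log (formChangeConst (M := M) (1 : Matrix (Fin d) (Fin d) ℝ) (1 + hamQuadForm (HamSpace.toHam w))) with hg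
    have hgL : ∀ a b : HamSpace ℂ d 𝔥 R n, |g a - g b| ≤ V * (c * ‖a - b‖) := fun a b =>
      abs_log_formChangeConst_seed_sub_le (M := M) a b (hball a) (hball b)
    have h1 : |g a₁₁ - g a₁₀ - g a₀₁ + g a₀₀| ≤ |g a₁₁ - g a₁₀| + |g a₀₀ - g a₀₁| := by
      have e : g a₁₁ - g a₁₀ - g a₀₁ + g a₀₀ = (g a₁₁ - g a₁₀) + (g a₀₀ - g a₀₁) := by ring
      rw [e]; exact abs_add_le _ _
    have h2 := hgL a₁₁ a₁₀
    have h3 := hgL a₀₀ a₀₁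
    rw [hcz] at h2 h3 ⊢
    simp only [zero_mul, mul_zero] at h2 h3
    have : |g a₁₁ - g a₁₀ - g a₀₁ + g a₀₀| ≤ 0 := by linarith
    simp only [zero_pow (two_ne_zero), mul_zero, zero_mul, add_zero]
    linarith [abs_nonneg (g a₁₁ - g a₁₀ - g a₀₁ + g a₀₀)]
  · have hcpos : 0 < c := lt_of_le_of_ne hc0 (Ne.symm hcz)
    -- radius `Rad = 1/(2c)`: the hypotheses are `‖a‖ ≤ Rad/3` and `‖a₁₁‖ ≤ Rad`
    set Rad : ℝ := 1 / (2 * c) with hRad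
    have hball : ∀ {w : HamSpace ℂ d 𝔥 R n}, ‖w‖ ≤ Rad → c * ‖w‖ ≤ 1 / 2 := fun hw => by
      calc c * ‖_‖ ≤ c * Rad := mul_le_mul_of_nonneg_left hw hc0
        _ = 1 / 2 := by rw [hRad]; field_simp
    have toRad : ∀ {w : HamSpace ℂ d 𝔥 R n} {s : ℝ}, c * ‖w‖ ≤ s → ‖w‖ ≤ s / c := fun hw => by
      rw [le_div_iff₀ hcpos, mul_comm]; exact hw
    set g : HamSpace ℂ d 𝔥 R n → ℝ := fun w =>
      Real.log (formChangeConst (M := M) (1 : Matrix (Fin d) (Fin d) ℝ) (1 + hamQuadForm (HamSpace.toHam w))) with hg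
    have hL : ∀ a b : HamSpace ℂ d 𝔥 R n, ‖a‖ ≤ Rad → ‖b‖ ≤ Rad → ‖g a - g b‖ ≤ (V * c) * ‖a - b‖ := by
      intro a b ha hb
      rw [Real.norm_eq_abs]
      have h := abs_log_formChangeConst_seed_sub_le (M := M) a b (hball ha) (hball hb)
      calc _ ≤ V * (c * ‖a - b‖) := h
        _ = (V * c) * ‖a - b‖ := by ring
    have hC : ∀ a u v : HamSpace ℂ d 𝔥 R n, ‖a‖ ≤ Rad → ‖a + u‖ ≤ Rad → ‖a + v‖ ≤ Rad → ‖a + u + v‖ ≤ Rad →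
        ‖g (a + u + v) - g (a + u) - g (a + v) + g a‖ ≤ (2 * V * c ^ 2) * ‖u‖ * ‖v‖ := by
      intro a u v ha hau hav hauv
      rw [Real.norm_eq_abs]
      have h := abs_secondDiff_log_formChangeConst_seed_le (M := M) a u v (hball ha) (hball hau) (hball hav) (hball hauv)
      calc _ ≤ 2 * V * (c * ‖u‖) * (c * ‖v‖) := h
        _ = (2 * V * c ^ 2) * ‖u‖ * ‖v‖ := by ring
    have hR3 : Rad / 3 = (1 / 6) / c := by rw [hRad]; field_simp; ring
    have hq := norm_secondDiff_quad_le (g := g) (R := Rad) (L := V * c) (C := 2 * V * c ^ 2) hL hC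
      (by rw [hR3]; exact toRad h₀₀) (by rw [hR3]; exact toRad h₁₀) (by rw [hR3]; exact toRad h₀₁)
      (by rw [hRad, show (1 : ℝ) / (2 * c) = (1 / 2) / c by field_simp]; exact toRad h₁₁)
    rw [Real.norm_eq_abs] at hq
    calc _ ≤ V * c * ‖a₁₁ - a₁₀ - a₀₁ + a₀₀‖ + 2 * V * c ^ 2 * ‖a₁₀ - a₀₀‖ * ‖a₀₁ - a₀₀‖ := hq
      _ = V * c * ‖a₁₁ - a₁₀ - a₀₁ + a₀₀‖ + 2 * V * c ^ 2 * ‖a₁₀ - a₀₀‖ * ‖a₀₁ - a₀₀‖ := rfl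

end Seed

end Summit.HubbardSuperconductivity.HubbardSuperconductivity.Theorems.ComplexGFF

end
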